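import Summits.AtomisticToContinuum.Crystallization.Theses.HullExactificationCascade
import Literature.MathematicalPhysics.StatisticalMechanics.CrystallizationSymmetries
import Literature.MathematicalPhysics.StatisticalMechanics.CrystallizationLocalLimit
import Summits.AtomisticToContinuum.Crystallization.Theorems.PalmUnimodularRigidityShellsToBarlowChartPowerTranslationB

/-!
# Route HullExactificationCascade — support (H) `HullPeriodicCrystallizes`

Settles item stmt-AtomisticToContinuum-12094 of route `HullExactificationCascade`
(sub-problem `Crystallization` of `AtomisticToContinuum`): if some hull element (two-sided
`ε`-matching on every ball, eventually along a translated subsequence) of a sequence of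
Lennard-Jones ground states is the image `g '' P.points` of a periodic configuration `P` under
an isometry `g` of `ℝ³`, then the convergence clause of Blanc–Lewin's `IsCrystallizing`
(Blanc–Lewin 2015, §2.1 (16)) holds for that sequence with multiplicity `m ≡ 1`.

Proof: Mazur–Ulam (`IsometryEquiv.toRealAffineIsometryEquiv`; the tree lemma `ptB_apply_eq` of
`PalmUnimodularRigidityShellsToBarlowChartPowerTranslationB.lean`) writes `g z = A z + g 0` with
`A` a linear isometry, so `g '' P.points` is the point set of the periodic configuration
`(P.isometryImage A).translate (g 0)` (`CrystallizationSymmetries.lean`); the translated ground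
states are uniformly separated (`LennardJonesMinimalDistance_holds`); the matching hypothesis is
then literally hypothesis `h` of `PeriodicConfiguration.tendsto_sum_of_eventually_near'`
(`CrystallizationLocalLimit.lean`).
-/

noncomputable section

namespace Summit.AtomisticToContinuum.Crystallization.Theorems

open Literature.MathematicalPhysics.StatisticalMechanics Filter Set

/-- The image of a periodic configuration under an isometry `g` of `ℝ³` is again (the point set
of) a periodic configuration: `g '' (F + G) = (A F + g 0) + A G` with `A` the linear part of
`g`. [folklore] -/
theorem hullPeriodic_exists_points_eq_image (P : PeriodicConfiguration 3)
    (g : EuclideanSpace ℝ (Fin 3) ≃ᵢ EuclideanSpace ℝ (Fin 3)) :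
    ∃ P' : PeriodicConfiguration 3, P'.points = g '' P.points := by
  set A := g.toRealAffineIsometryEquiv.linearIsometryEquiv with hA
  refine ⟨(P.isometryImage A).translate (g 0), Set.ext fun z => ?_⟩
  rw [PeriodicConfiguration.mem_points_translate, PeriodicConfiguration.mem_points_isometryImage]
  have hz : g (A.symm (z - g 0)) = z := by
    rw [PalmUnimodularRigidityShellsToBarlowChart.ptB_apply_eq g, ← hA,
      LinearIsometryEquiv.apply_symm_apply, sub_add_cancel]
  constructor
  · intro h
    exact ⟨A.symm (z - g 0), h, hz⟩
  · rintro ⟨p, hp, rfl⟩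
    have : A.symm (g p - g 0) = p := by
      rw [PalmUnimodularRigidityShellsToBarlowChart.ptB_apply_eq g p, ← hA, add_sub_cancel_right,
        LinearIsometryEquiv.symm_apply_apply]
    rwa [this]

/-- **Support (H) of route `HullExactificationCascade`** (item stmt-AtomisticToContinuum-12094):
a periodic point set `g '' P.points` in the hull of a sequence of Lennard-Jones ground states
gives the convergence clause of `IsCrystallizing` (Blanc–Lewin 2015, (16)) along the same
subsequence and translations, with limit configuration `(P.isometryImage A).translate (g 0)`
and multiplicity `m ≡ 1`. [folklore] -/
theorem hullPeriodicCrystallizes_proof :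
    Summit.AtomisticToContinuum.Crystallization.Theses.HullExactificationCascade.HullPeriodicCrystallizes := by
  unfold Summit.AtomisticToContinuum.Crystallization.Theses.HullExactificationCascade.HullPeriodicCrystallizes
  intro x hx hhull
  obtain ⟨P, g, φ, hφ, τ, hmatch⟩ := hhull
  obtain ⟨P', hP'⟩ := hullPeriodic_exists_points_eq_image P g
  obtain ⟨δ, hδ, hsep⟩ := LennardJonesMinimalDistance_holds
  refine ⟨φ, τ, P', fun _ => 1, hφ, fun _ _ => le_rfl, fun _ _ _ => rfl, ?_⟩
  intro f hfc hf
  have hsep' : ∀ (j : ℕ) (i i' : Fin (φ j)), i ≠ i' →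
      δ ≤ dist (x (φ j) i + τ j) (x (φ j) i' + τ j) := by
    intro j i i' hii'
    rw [dist_add_right]
    exact hsep (φ j) (x (φ j)) (hx (φ j)) i i' hii'
  have h' : ∀ R ε : ℝ, 0 < ε → ∀ᶠ j in atTop,
      (∀ s ∈ P'.points, ‖s‖ ≤ R → ∃ i : Fin (φ j), dist (x (φ j) i + τ j) s ≤ ε) ∧
      (∀ i : Fin (φ j), ‖x (φ j) i + τ j‖ ≤ R → ∃ s ∈ P'.points, dist (x (φ j) i + τ j) s ≤ ε) := by
    intro R ε hε
    rw [hP']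
    exact hmatch R ε hε
  exact P'.tendsto_sum_of_eventually_near' (fun j (i : Fin (φ j)) => x (φ j) i + τ j) hδ hsep' h' hfc hf

end Summit.AtomisticToContinuum.Crystallization.Theorems

end
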